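import Literature.Analysis.FluidPDE.TypeIAncientMild
import Literature.Analysis.FluidPDE.OseenDuhamelMorreyFarField
import Literature.Analysis.FluidPDE.BallCutoff
import HarnessLib

/-!
# Crux `ClockStretchingLaw.ClockLaw` (stmt-NavierStokesRegularity-10571), line `registered`:
# `stub_pressureRepr` — the far remainder of the Oseen–Duhamel term of a Type-I model

Helper file (theorems only) for the stub `stub_pressureRepr` of the birth line of the crux
`ClockLaw`. Let `u` be a Type-I KNSS-mild field (`IsTypeIAncientMild C u`) with the scale-invariant
energy bound `∫_{B(x₀,r)} ‖u(t)‖² ≤ C r` (`t < 0`), and for a cut-off scale `L` let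
`χ_L = ballCutoff 0 L` (`= 1` on `B̄(0,2L)`, `= 0` off `B(0,3L)`, values in `[0,1]`) and
`V_L(τ, y) = χ_L(y) u(τ, y)`. By bilinearity of the Oseen kernel `K`,
`K[u,u] - K[χ_L u, χ_L u] = (1 - χ_L²) K[u,u] = K[N_L, N_L]` with `N_L = √(1 - χ_L²) u`, so

  `B¹_s(u,u)(t)(x) - B¹_s(V_L,V_L)(t)(x) = B¹_s(N_L,N_L)(t)(x)`
  (`pressureRepr_oseenDuhamel_sub_eq`, absolute convergence for bounded measurable fields),

and since `N_L` vanishes on `B(0, 2L) ⊇ B(x, L)` for `‖x‖ < 2 ≤ L`, the right-hand side is the part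
of the Duhamel term radiated from distance `≥ L`, which the tree's dyadic far-field bound
(`exists_norm_setIntegral_farField_oseenKernel_le_of_integral`, kernel decay
`|K(σ,z)| ≲ (σ + |z|²)⁻²` of Koch–Tataru / KNSS (3.8)) controls by `c C / L`:

  `‖B¹_s(u,u)(t)(x) - B¹_s(V_L,V_L)(t)(x)‖ ≤ c C / L` for `s < t < 0`, `‖x‖ < 2`, `L ≥ 2`
  (`pressureRepr_exists_duhamel_far_bound`), uniformly in `s`, `t`.
-/

noncomputable section

open MeasureTheory Filter Topology Set Metric Function
open Literature.Analysis Literature.Analysis.FluidPDE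
open scoped Topology NNReal ENNReal InnerProductSpace RealInnerProductSpace

-- Summit = Problem namespace duplication is the tree's layout (CONVENTIONS §1); as in every Theorems file.
set_option linter.dupNamespace false

namespace Summit.NavierStokesRegularity.NavierStokesRegularity.Theorems.ClockLaw.Birth

/-- Local notation: `ℝ³`. -/
local notation "E3" => EuclideanSpace ℝ (Fin 3)

variable {C : ℝ} {u : ℝ → E3 → E3}

/-! ### Weighted copies of a Type-I field on a slab -/

/-- A weighted copy `(τ, y) ↦ g(y) u(τ, y)` of a Type-I field, `g` continuous, is jointly a.e.
strongly measurable on every slab `(s, T) × ℝ³`, `T ≤ 0`. [folklore] -/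
theorem pressureRepr_aestronglyMeasurable_weight (hu : IsTypeIAncientMild C u) {g : E3 → ℝ}
    (hg : Continuous g) {s T : ℝ} (hT : T ≤ 0) :
    AEStronglyMeasurable (uncurry fun τ y => g y • u τ y)
      ((volume : Measure (ℝ × E3)).restrict (Ioo s T ×ˢ univ)) := by
  have h1 : AEStronglyMeasurable (fun p : ℝ × E3 => g p.2)
      ((volume : Measure (ℝ × E3)).restrict (Ioo s T ×ˢ univ)) :=
    (hg.comp continuous_snd).aestronglyMeasurable
  exact h1.smul (hu.aestronglyMeasurable_uncurry hT)

/-- A weighted copy with `|g| ≤ 1` obeys the Type-I bound `‖g(y) u(τ,y)‖ ≤ C/√(-T)` on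
`(s, T) × ℝ³`, `T < 0`. [folklore] -/
theorem pressureRepr_norm_weight_le (hu : IsTypeIAncientMild C u) {g : E3 → ℝ}
    (hg1 : ∀ y, |g y| ≤ 1) {s T : ℝ} (hT : T < 0) :
    ∀ τ ∈ Ioo s T, ∀ y, ‖g y • u τ y‖ ≤ C / Real.sqrt (-T) := by
  intro τ hτ y
  rw [norm_smul, Real.norm_eq_abs]
  calc |g y| * ‖u τ y‖ ≤ 1 * ‖u τ y‖ := mul_le_mul_of_nonneg_right (hg1 y) (norm_nonneg _)
    _ ≤ C / Real.sqrt (-T) := by rw [one_mul]; exact hu.norm_le_of_mem_Ioo hT hτ y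

/-- `|χ_L| ≤ 1`. [folklore] -/
theorem pressureRepr_abs_ballCutoff_le (L : ℝ) (y : E3) : |ballCutoff 0 L y| ≤ 1 :=
  abs_ballCutoff_le_one 0 L y

/-- `0 ≤ 1 - χ_L²`. [folklore] -/
theorem pressureRepr_one_sub_sq_nonneg (L : ℝ) (y : E3) : 0 ≤ 1 - ballCutoff 0 L y ^ 2 := by
  have h0 := ballCutoff_nonneg 0 L y
  have h1 := ballCutoff_le_one 0 L y
  nlinarith

/-- `|√(1 - χ_L²)| ≤ 1`. [folklore] -/
theorem pressureRepr_abs_sqrt_le (L : ℝ) (y : E3) : |Real.sqrt (1 - ballCutoff 0 L y ^ 2)| ≤ 1 := by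
  rw [abs_of_nonneg (Real.sqrt_nonneg _), Real.sqrt_le_one]
  have h0 := ballCutoff_nonneg 0 L y
  nlinarith

/-- `√(1 - χ_L²)` is continuous. [folklore] -/
theorem pressureRepr_continuous_sqrt (L : ℝ) :
    Continuous fun y : E3 => Real.sqrt (1 - ballCutoff 0 L y ^ 2) :=
  Real.continuous_sqrt.comp (continuous_const.sub ((contDiff_ballCutoff 0 L (n := 0)).continuous.pow 2))

/-- `√(1 - χ_L²)(y) = 0` for `‖y‖ ≤ 2L` (`L > 0`). [folklore] -/
theorem pressureRepr_sqrt_eq_zero {L : ℝ} (hL : 0 < L) {y : E3} (hy : ‖y‖ ≤ 2 * L) :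
    Real.sqrt (1 - ballCutoff 0 L y ^ 2) = 0 := by
  rw [ballCutoff_eq_one hL (by rwa [sub_zero]), one_pow, sub_self, Real.sqrt_zero]

/-! ### The splitting `K[u,u] - K[χu, χu] = K[N, N]` -/

/-- Pointwise: `K[a,a] - K[c a, c a] = K[√(1-c²) a, √(1-c²) a]` for `0 ≤ 1 - c²`. [folklore] -/
theorem pressureRepr_oseenKernel_split (σ : ℝ) (z a : E3) {c : ℝ} (hc : 0 ≤ 1 - c ^ 2) :
    oseenKernel σ z a a - oseenKernel σ z (c • a) (c • a) =
      oseenKernel σ z (Real.sqrt (1 - c ^ 2) • a) (Real.sqrt (1 - c ^ 2) • a) := by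
  rw [oseenKernel_smul_left, oseenKernel_smul_right, oseenKernel_smul_left, oseenKernel_smul_right,
    smul_smul, smul_smul, Real.mul_self_sqrt hc, sub_smul, one_smul, pow_two]

/-- **The splitting of the Duhamel term**: for `s < t < 0` and every `x`,
`B¹_s(u,u)(t)(x) - B¹_s(χ_L u, χ_L u)(t)(x) = B¹_s(N_L, N_L)(t)(x)`, `N_L = √(1-χ_L²) u` (product
form of the three absolutely convergent Duhamel integrals of bounded measurable fields). [folklore] -/
theorem pressureRepr_oseenDuhamel_sub_eq (hu : IsTypeIAncientMild C u) (L : ℝ) {s t : ℝ}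
    (hst : s < t) (ht : t < 0) (x : E3) :
    oseenDuhamel 1 s u u t x -
        oseenDuhamel 1 s (fun τ y => ballCutoff 0 L y • u τ y) (fun τ y => ballCutoff 0 L y • u τ y) t x =
      oseenDuhamel 1 s (fun τ y => Real.sqrt (1 - ballCutoff 0 L y ^ 2) • u τ y)
        (fun τ y => Real.sqrt (1 - ballCutoff 0 L y ^ 2) • u τ y) t x := by
  have hM : 0 ≤ C / Real.sqrt (-t) := div_nonneg hu.nonneg (Real.sqrt_nonneg _)
  have hum := hu.aestronglyMeasurable_uncurry (s := s) ht.le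
  have huM : ∀ τ ∈ Ioo s t, ∀ y, ‖u τ y‖ ≤ C / Real.sqrt (-t) :=
    fun τ hτ y => hu.norm_le_of_mem_Ioo ht hτ y
  have hVm := pressureRepr_aestronglyMeasurable_weight hu
    (contDiff_ballCutoff 0 L (n := 0)).continuous (s := s) ht.le
  have hVM := pressureRepr_norm_weight_le hu (pressureRepr_abs_ballCutoff_le L) (s := s) ht
  have hNm := pressureRepr_aestronglyMeasurable_weight hu (pressureRepr_continuous_sqrt L)
    (s := s) ht.le
  have hNM := pressureRepr_norm_weight_le hu (pressureRepr_abs_sqrt_le L) (s := s) ht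
  rw [oseenDuhamel_eq_integral_prod one_pos hum hum hM huM huM hst le_rfl x,
    oseenDuhamel_eq_integral_prod one_pos hVm hVm hM hVM hVM hst le_rfl x,
    oseenDuhamel_eq_integral_prod one_pos hNm hNm hM hNM hNM hst le_rfl x,
    ← integral_sub (integrable_oseenKernel_duhamel_bounded one_pos hum hum hM huM huM hst le_rfl x)
      (integrable_oseenKernel_duhamel_bounded one_pos hVm hVm hM hVM hVM hst le_rfl x)]
  refine integral_congr_ae (Eventually.of_forall fun p => ?_)
  exact pressureRepr_oseenKernel_split _ _ _ (pressureRepr_one_sub_sq_nonneg L p.2)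

/-- **The remainder is radiated from distance `≥ L`**: for `‖x‖ < 2 ≤ L`,
`B¹_s(N_L,N_L)(t)(x) = ∫_{(s,t)} ∫_{‖y-x‖ ≥ L} K(t-τ, x-y)[N_L, N_L] dy dτ` (`N_L = 0` on
`B(0,2L) ⊇ B(x,L)`). [folklore] -/
theorem pressureRepr_oseenDuhamel_sqrt_eq_far {L : ℝ} (hL : 2 ≤ L) (s t : ℝ) {x : E3}
    (hx : ‖x‖ < 2) :
    oseenDuhamel 1 s (fun τ y => Real.sqrt (1 - ballCutoff 0 L y ^ 2) • u τ y)
        (fun τ y => Real.sqrt (1 - ballCutoff 0 L y ^ 2) • u τ y) t x =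
      ∫ τ in Ioo s t, ∫ y in {y | L ≤ ‖y - x‖},
        oseenKernel (t - τ) (x - y) (Real.sqrt (1 - ballCutoff 0 L y ^ 2) • u τ y)
          (Real.sqrt (1 - ballCutoff 0 L y ^ 2) • u τ y) := by
  rw [oseenDuhamel_apply]
  refine setIntegral_congr_fun measurableSet_Ioo fun τ _ => ?_
  rw [one_mul]
  refine (setIntegral_eq_integral_of_forall_compl_eq_zero fun y hy => ?_).symm
  have hy' : ‖y - x‖ < L := by simpa using hy
  have hyL : ‖y‖ ≤ 2 * L := by
    have := norm_le_norm_add_norm_sub' y x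
    have : ‖y‖ ≤ ‖x‖ + ‖y - x‖ := by
      calc ‖y‖ = ‖x + (y - x)‖ := by rw [add_sub_cancel]
        _ ≤ ‖x‖ + ‖y - x‖ := norm_add_le _ _
    linarith
  rw [pressureRepr_sqrt_eq_zero (by linarith) hyL, zero_smul, oseenKernel_zero_left]

/-- **The far remainder of the Duhamel term of a Type-I model is `O(C/L)` on `B(0,2)`**: there is
an absolute `c > 0` such that for every Type-I KNSS-mild field `u` with the scale-invariant energy
bound `∫_{B(x₀,r)} ‖u(t)‖² ≤ C r`, every `L ≥ 2`, `s < t < 0` and `‖x‖ < 2`,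
`‖B¹_s(u,u)(t)(x) - B¹_s(χ_L u, χ_L u)(t)(x)‖ ≤ c C / L`. [folklore] -/
theorem pressureRepr_exists_duhamel_far_bound :
    ∃ c : ℝ, 0 < c ∧ ∀ {C : ℝ} {u : ℝ → E3 → E3}, IsTypeIAncientMild C u →
      (∀ t < 0, ∀ (x₀ : E3) (r : ℝ), 0 < r → ∫ y in ball x₀ r, ‖u t y‖ ^ 2 ≤ C * r) →
      ∀ {L : ℝ}, 2 ≤ L → ∀ {s t : ℝ}, s < t → t < 0 → ∀ {x : E3}, ‖x‖ < 2 →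
        ‖oseenDuhamel 1 s u u t x -
            oseenDuhamel 1 s (fun τ y => ballCutoff 0 L y • u τ y)
              (fun τ y => ballCutoff 0 L y • u τ y) t x‖ ≤ c * C / L := by
  obtain ⟨c, hc, hfar⟩ := exists_norm_setIntegral_farField_oseenKernel_le_of_integral
  refine ⟨c, hc, fun {C u} hu hA {L} hL {s t} hst ht {x} hx => ?_⟩
  have hL0 : 0 < L := by linarith
  rw [pressureRepr_oseenDuhamel_sub_eq hu L hst ht x, pressureRepr_oseenDuhamel_sqrt_eq_far hL s t hx]
  set N : ℝ → E3 → E3 := fun τ y => Real.sqrt (1 - ballCutoff 0 L y ^ 2) • u τ y with hN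
  have hNc : ∀ τ < 0, Continuous (N τ) := fun τ hτ =>
    (pressureRepr_continuous_sqrt L).smul (hu.continuous_slice hτ)
  have hNle : ∀ τ y, ‖N τ y‖ ^ 2 ≤ ‖u τ y‖ ^ 2 := by
    intro τ y
    have h1 : ‖N τ y‖ ≤ ‖u τ y‖ := by
      simp only [hN, norm_smul, Real.norm_eq_abs]
      calc |Real.sqrt (1 - ballCutoff 0 L y ^ 2)| * ‖u τ y‖ ≤ 1 * ‖u τ y‖ :=
            mul_le_mul_of_nonneg_right (pressureRepr_abs_sqrt_le L y) (norm_nonneg _)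
        _ = ‖u τ y‖ := one_mul _
    exact pow_le_pow_left₀ (norm_nonneg _) h1 2
  have hint : ∀ τ ∈ Ioo s t, ∀ r > 0, IntegrableOn (fun y => ‖N τ y‖ ^ 2) (ball x r) volume := by
    intro τ hτ r _
    exact ((((hNc τ (hτ.2.trans ht)).norm).pow 2).continuousOn.integrableOn_compact
      (isCompact_closedBall x r)).mono_set ball_subset_closedBall
  have hMor : ∀ τ ∈ Ioo s t, ∀ r > 0, ∫ y in ball x r, ‖N τ y‖ ^ 2 ≤ C * r := by
    intro τ hτ r hr
    have hτ0 : τ < 0 := hτ.2.trans ht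
    have hui : IntegrableOn (fun y => ‖u τ y‖ ^ 2) (ball x r) volume :=
      ((((hu.continuous_slice hτ0).norm).pow 2).continuousOn.integrableOn_compact
        (isCompact_closedBall x r)).mono_set ball_subset_closedBall
    exact (setIntegral_mono (hint τ hτ r hr) hui fun y => hNle τ y).trans (hA τ hτ0 x r hr)
  exact hfar hu.nonneg hL0 hint hMor

end Summit.NavierStokesRegularity.NavierStokesRegularity.Theorems.ClockLaw.Birth

end
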